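import Mathlib.Algebra.Module.Basic
import Mathlib.Data.Int.Basic
import Mathlib.Algebra.Group.Pi.Basic
import Mathlib.Algebra.Module.Pi
import Mathlib.Tactic.Abel
import Mathlib.Tactic.Module
import HarnessLib

/-!
# K2R `RealisedQuasiStaticCellLaw`, line `floquet-bloch`: relabeling a Bloch sector by any of its representatives
# (helper towards `stub_lowSectorDecay`; `--supports stmt-AnomalousDissipation-20446`)

Summits-side helper file (everything proved; no definitions, no named facts). The symmetric Bloch sector `±ℓ + nℤ³` is unchanged
when `ℓ` is replaced by any `ℓ' ≡ ±ℓ (mod n)` (`sector_iff_of_rep`): the low-sector hypothesis of `stub_lowSectorDecay` provides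
such a representative `ℓ'` with `|ℓ'|² < Q`, and the decay pipeline (`sectorDecay_ae`) is then run with the label `ℓ'` (or `-ℓ'`,
`sector_iff_neg`) — the support hypothesis `hsupp` transfers verbatim (recipe v2 §(i)).
-/

set_option linter.dupNamespace false

namespace Summit.AnomalousDissipation.AnomalousDissipation.Theorems.SolenoidalFractalHomogenisation.RealisedQuasiStaticCellLaw

/-- **A sector is determined by any representative**: if `ℓ' ≡ ±ℓ (mod n)` then `±ℓ + nℤ³ = ±ℓ' + nℤ³`. -/
theorem sector_iff_of_rep {ℓ ℓ' : Fin 3 → ℤ} {n : ℕ}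
    (h : (∃ z : Fin 3 → ℤ, ℓ' = ℓ + (n : ℤ) • z) ∨ (∃ z : Fin 3 → ℤ, ℓ' = -ℓ + (n : ℤ) • z)) (k : Fin 3 → ℤ) :
    ((∃ z : Fin 3 → ℤ, k = ℓ + (n : ℤ) • z) ∨ (∃ z : Fin 3 → ℤ, k = -ℓ + (n : ℤ) • z)) ↔
      ((∃ z : Fin 3 → ℤ, k = ℓ' + (n : ℤ) • z) ∨ (∃ z : Fin 3 → ℤ, k = -ℓ' + (n : ℤ) • z)) := by
  rcases h with ⟨z₀, hz₀⟩ | ⟨z₀, hz₀⟩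
  · constructor
    · rintro (⟨z, rfl⟩ | ⟨z, rfl⟩)
      · exact Or.inl ⟨z - z₀, by rw [hz₀]; module⟩
      · exact Or.inr ⟨z + z₀, by rw [hz₀]; module⟩
    · rintro (⟨z, rfl⟩ | ⟨z, rfl⟩)
      · exact Or.inl ⟨z + z₀, by rw [hz₀]; module⟩
      · exact Or.inr ⟨z - z₀, by rw [hz₀]; module⟩
  · constructor
    · rintro (⟨z, rfl⟩ | ⟨z, rfl⟩)
      · exact Or.inr ⟨z + z₀, by rw [hz₀]; module⟩
      · exact Or.inl ⟨z - z₀, by rw [hz₀]; module⟩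
    · rintro (⟨z, rfl⟩ | ⟨z, rfl⟩)
      · exact Or.inr ⟨z + z₀, by rw [hz₀]; module⟩
      · exact Or.inl ⟨z - z₀, by rw [hz₀]; module⟩

/-- The sector is symmetric: relabeling by `-ℓ`. -/
theorem sector_iff_neg (ℓ : Fin 3 → ℤ) (n : ℕ) (k : Fin 3 → ℤ) :
    ((∃ z : Fin 3 → ℤ, k = ℓ + (n : ℤ) • z) ∨ (∃ z : Fin 3 → ℤ, k = -ℓ + (n : ℤ) • z)) ↔
      ((∃ z : Fin 3 → ℤ, k = -ℓ + (n : ℤ) • z) ∨ (∃ z : Fin 3 → ℤ, k = -(-ℓ) + (n : ℤ) • z)) :=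
  sector_iff_of_rep (Or.inr ⟨0, by simp⟩) k

/-- Scaling the representative by a sign `σ = ±1` does not change the sector. -/
theorem sector_iff_sign (ℓ : Fin 3 → ℤ) (n : ℕ) {σ : ℤ} (hσ : σ = 1 ∨ σ = -1) (k : Fin 3 → ℤ) :
    ((∃ z : Fin 3 → ℤ, k = ℓ + (n : ℤ) • z) ∨ (∃ z : Fin 3 → ℤ, k = -ℓ + (n : ℤ) • z)) ↔
      ((∃ z : Fin 3 → ℤ, k = σ • ℓ + (n : ℤ) • z) ∨ (∃ z : Fin 3 → ℤ, k = -(σ • ℓ) + (n : ℤ) • z)) := by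
  rcases hσ with rfl | rfl
  · simp only [one_smul]
  · rw [neg_smul, one_smul]
    exact sector_iff_neg ℓ n k

end Summit.AnomalousDissipation.AnomalousDissipation.Theorems.SolenoidalFractalHomogenisation.RealisedQuasiStaticCellLaw
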